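import Literature.Probability.LatticeModels.WeightedCurrentsIdentities
import Literature.Probability.LatticeModels.IsingTransport
import Literature.Probability.LatticeModels.IsingProductCovarianceBound
import HarnessLib

/-!
# Odd–odd spin products are bounded by the cross two-point functions (zero field), and the SHARP
# form of Duminil-Copin–Goswami–Raoufi's Lemma 1.2: `Cov(σ_A, σ_B) ≤ ∑_{a∈A, b∈B} ⟨σ_a ; σ_b⟩`

Topic `Literature/Probability/LatticeModels`. Theorem-only file (no definitions, no named facts).

1. **The odd–odd bound** (the «correlation inequality coming from the Edwards–Sokal coupling» in
   the proof of H. Duminil-Copin, S. Goswami, A. Raoufi, Comm. Math. Phys. **374** (2020),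
   arXiv:1808.00439 [DuminilCopinGoswamiRaoufi2020], Lemma 1.2, p. 8: «Since `A'` and `B'` are sets
   of odd cardinality, one can use `⟨σ_{A'∪B'}⟩_{G∖S} ≤ ∑_{a∈A', b∈B'} ⟨σ_aσ_b⟩_{G∖S}` … the fact
   that `𝓕_{A'∪B'}` is included in the event that some `a ∈ A'` is connected to some `b ∈ B'`»): for
   the ferromagnetic nearest-neighbour Ising model with FREE boundary condition and ZERO field on a
   finite graph (§1, any edge couplings `K ≥ 0` in the current form) or a finite volume of a locally
   finite graph (§2), and disjoint `A', B'` with `|A'|` odd,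
   `⟨σ_{A'}σ_{B'}⟩ ≤ ∑_{a∈A'} ∑_{b∈B'} ⟨σ_{A'∪B'∖{a,b}}⟩ ⟨σ_aσ_b⟩ ≤ ∑_{a∈A'} ∑_{b∈B'} ⟨σ_aσ_b⟩`.
   Proof here by random currents instead of Edwards–Sokal: a current with sources `A' ∪ B'` has a
   cluster containing an odd number of points of `A'`, hence (every cluster containing an even
   number of sources) a point of `B'` — `Current.exists_mem_cluster_of_odd` — and the pair
   switching lemma (tree `Current.tsum_epairWeight_switch_pair`) turns `𝟙[a ↔ b]` into
   `Z[A'∪B' ∆ {a,b}] Z[{a,b}]`.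
2. **The sharp covariance bound** (§3): plugging the odd–odd bound (constant `1`) instead of
   Newman's Gaussian bound (constant `(|A|+|B|)!`) into the Ginibre-duplication engine of
   `IsingProductCovarianceBound.lean` (`gksExpect_cov_le_mul_sum_truncated_of_oddOdd`, whose inner
   systems are free zero-field Ising models on sub-volumes, `gksExpect_twistIn_ising_eq_isingCorr_free`)
   gives, for the Ising model on ANY locally finite graph, finite volume `Λ`, free or plus boundary
   condition, `β, h ≥ 0`, and disjoint `A, B ⊆ Λ`:
   `0 ≤ ⟨σ_Aσ_B⟩ - ⟨σ_A⟩⟨σ_B⟩ ≤ ∑_{a∈A} ∑_{b∈B} (⟨σ_aσ_b⟩ - ⟨σ_a⟩⟨σ_b⟩)`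
   (`isingCorr_cov_disjoint_le_sum_truncated`) — Duminil-Copin–Goswami–Raoufi's Lemma 1.2 with the
   constant `1` in place of the printed `2^{|A|+|B|-4}`, on general graphs and with a field; and the
   plus ∕ free states of `ℤ^d` (`plusCorr_cov_disjoint_le_sum_truncated`, `freeCorr_…`). For
   `|A| = |B| = 2` this is the tree's Lebowitz bound `isingCorr_cov_pair_le_sum_truncated`.

Purpose (cell `ym-ir`, rows A5 ∕ A9): constants polynomial in `|A|, |B|` make the Wilson-loop
clustering bounds of `ℤ₂` lattice gauge theory on `ℤ³` grow only exponentially in the loop AREA,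
which is what Duncan–Schweinhart's Prop. 24 for GROWING loops `f(N) = o(√N)` needs
(`IsingGaugeWilsonLoopCovarianceGrowing.lean`). HONEST FRAMING: Ising-model correlation
inequalities; nothing here bears on Yang–Mills or the mass gap (Clay).

## References

* H. Duminil-Copin, S. Goswami, A. Raoufi, CMP 374 (2020), arXiv:1808.00439, Lemma 1.2 and its
  proof, p. 8. [DuminilCopinGoswamiRaoufi2020]
* M. Aizenman, Comm. Math. Phys. 86 (1982) 1–48, §3 (switching lemma, source constraints and
  clusters). [Aizenman1982]
* H. Duminil-Copin, *Random currents expansion of the Ising model*, arXiv:1607.06933 (2016), §2.2,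
  Lemma 2.2. [DuminilCopin2016]
* S. Friedli, Y. Velenik, *Statistical Mechanics of Lattice Systems* (CUP 2017), §3.8.1 Thm. 3.49. [FriedliVelenik2017]
-/

noncomputable section

open Finset Filter Topology
open scoped symmDiff ENNReal

namespace Literature.Probability.LatticeModels

/-! ### §1 Finite graphs: the current argument -/

section Finite

variable {V : Type*} [Fintype V] [DecidableEq V] {G : SimpleGraph V} [DecidableRel G.Adj]

namespace Current

/-- **A current with sources `A' ∪ B'`, `|A'|` odd, joins some `a ∈ A'` to some `b ∈ B'`.** Every
cluster contains an even number of sources (`even_card_sources_filter_reachable`); if no cluster of a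
point of `A'` met `B'`, the clusters would partition `A'` into classes of even size.
[cite: DuminilCopinGoswamiRaoufi2020, proof of Lemma 1.2 (p. 8, «𝓕_{A'∪B'} is included in the event that some a ∈ A' is connected to some b ∈ B'»); Aizenman1982 §3] -/
theorem exists_mem_cluster_of_odd (n : Current G) {A' B' : Finset V} (hAB : Disjoint A' B')
    (hA : Odd A'.card) (hs : n.sources = A' ∪ B') : ∃ a ∈ A', ∃ b ∈ B', b ∈ n.cluster a := by
  classical
  set R : V → V → Prop := fun u v => (Percolation.openGraph n.traced).Reachable u v with hR
  have hrefl : ∀ u, R u u := fun u => SimpleGraph.Reachable.refl u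
  have hsymm : ∀ {u v}, R u v → R v u := fun h => SimpleGraph.Reachable.symm h
  have htrans : ∀ {u v w}, R u v → R v w → R u w := fun h1 h2 => SimpleGraph.Reachable.trans h1 h2
  by_contra hno
  push Not at hno
  have hno' : ∀ a ∈ A', ∀ b ∈ B', ¬R a b := fun a ha b hb h => hno a ha b hb (mem_cluster_iff.2 h)
  -- the class of `a` inside `A'`
  set cls : V → Finset V := fun a => A'.filter fun u => R a u with hcls
  have heven : ∀ a ∈ A', Even (cls a).card := by
    intro a ha
    have h := even_card_sources_filter_reachable n a
    rw [hs, Finset.filter_union, Finset.card_union_of_disjoint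
      (Finset.disjoint_filter_filter hAB)] at h
    have h0 : (B'.filter fun u => R a u) = ∅ :=
      Finset.filter_eq_empty_iff.2 fun b hb hab => hno' a ha b hb hab
    rw [h0, Finset.card_empty, add_zero] at h
    exact h
  -- the fibres of `cls` on `A'` are the classes themselves
  have hfib : ∀ a ∈ A', (A'.filter fun a' => cls a' = cls a) = cls a := by
    intro a ha
    ext a'
    simp only [Finset.mem_filter, hcls]
    constructor
    · rintro ⟨ha', heq⟩
      refine ⟨ha', ?_⟩
      have : a' ∈ A'.filter fun u => R a' u := Finset.mem_filter.2 ⟨ha', hrefl a'⟩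
      rw [heq] at this
      exact (Finset.mem_filter.1 this).2
    · rintro ⟨ha', haa'⟩
      refine ⟨ha', ?_⟩
      ext u
      simp only [Finset.mem_filter]
      exact ⟨fun ⟨hu, h⟩ => ⟨hu, htrans haa' h⟩, fun ⟨hu, h⟩ => ⟨hu, htrans (hsymm haa') h⟩⟩
  have hcard : A'.card = ∑ c ∈ A'.image cls, (A'.filter fun a' => cls a' = c).card :=
    Finset.card_eq_sum_card_image cls A'
  have hevenA : Even A'.card := by
    rw [hcard]
    refine Finset.even_sum _ fun c hc => ?_
    obtain ⟨a, ha, rfl⟩ := Finset.mem_image.1 hc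
    rw [hfib a ha]
    exact heven a ha
  exact (Nat.not_even_iff_odd.2 hA) hevenA

variable {K : G.edgeFinset → ℝ}

/-- **The odd–odd bound, current-sum form** (edge couplings `K ≥ 0`, disjoint `A', B'`, `|A'|` odd):
`Z[A'∪B'] · Z[∅] ≤ ∑_{a∈A'} ∑_{b∈B'} Z[(A'∪B') ∆ {a,b}] · Z[{a,b}]` — union bound over the pair
`(a,b)` joined by the current (`exists_mem_cluster_of_odd`) and the pair switching lemma
`∑_{∂n₁ = S, ∂n₂ = ∅} w w 𝟙[a ↔ b] = Z[S ∆ {a,b}] Z[{a,b}]`.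
[cite: DuminilCopinGoswamiRaoufi2020, proof of Lemma 1.2 (p. 8); Aizenman1982 §3, Lemma 3.2] -/
theorem ecurrentSum_oddUnion_mul_empty_le (hK : ∀ e, 0 ≤ K e) {A' B' : Finset V}
    (hAB : Disjoint A' B') (hA : Odd A'.card) :
    ecurrentSum K (A' ∪ B') * ecurrentSum K ∅ ≤
      ∑ a ∈ A', ∑ b ∈ B', ecurrentSum K ((A' ∪ B') ∆ ({a} ∆ {b})) * ecurrentSum K ({a} ∆ {b}) := by
  classical
  rw [← tsum_epairWeight]
  have hpt : ∀ p : Current G × Current G, epairWeight K (A' ∪ B') ∅ p ≤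
      ∑ a ∈ A', ∑ b ∈ B', epairWeight K (A' ∪ B') ∅ p *
        ((1 : ℝ≥0∞) * if b ∈ (p.1 + p.2).cluster a then 1 else 0) := by
    intro p
    by_cases hsrc : p.1.sources = A' ∪ B' ∧ p.2.sources = ∅
    · have hs : (p.1 + p.2).sources = A' ∪ B' := by
        rw [sources_add, hsrc.1, hsrc.2]; exact symmDiff_bot _
      obtain ⟨a, ha, b, hb, hab⟩ := exists_mem_cluster_of_odd (p.1 + p.2) hAB hA hs
      calc epairWeight K (A' ∪ B') ∅ p
          = epairWeight K (A' ∪ B') ∅ p * ((1 : ℝ≥0∞) *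
              if b ∈ (p.1 + p.2).cluster a then 1 else 0) := by rw [if_pos hab, mul_one, mul_one]
        _ ≤ ∑ b ∈ B', epairWeight K (A' ∪ B') ∅ p * ((1 : ℝ≥0∞) *
              if b ∈ (p.1 + p.2).cluster a then 1 else 0) :=
            Finset.single_le_sum (f := fun b => epairWeight K (A' ∪ B') ∅ p *
              ((1 : ℝ≥0∞) * if b ∈ (p.1 + p.2).cluster a then 1 else 0))
              (fun _ _ => bot_le) hb
        _ ≤ _ := Finset.single_le_sum (f := fun a => ∑ b ∈ B', epairWeight K (A' ∪ B') ∅ p *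
              ((1 : ℝ≥0∞) * if b ∈ (p.1 + p.2).cluster a then 1 else 0))
              (fun _ _ => bot_le) ha
    · have h0 : epairWeight K (A' ∪ B') ∅ p = 0 := by unfold epairWeight; rw [if_neg hsrc]
      rw [h0]; exact bot_le
  calc ∑' p, epairWeight K (A' ∪ B') ∅ p
      ≤ ∑' p, ∑ a ∈ A', ∑ b ∈ B', epairWeight K (A' ∪ B') ∅ p *
          ((1 : ℝ≥0∞) * if b ∈ (p.1 + p.2).cluster a then 1 else 0) :=
        ENNReal.tsum_le_tsum hpt
    _ = ∑ a ∈ A', ∑ b ∈ B', ∑' p, epairWeight K (A' ∪ B') ∅ p *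
          ((1 : ℝ≥0∞) * if b ∈ (p.1 + p.2).cluster a then 1 else 0) := by
        rw [Summable.tsum_finsetSum (fun _ _ => ENNReal.summable)]
        exact Finset.sum_congr rfl fun a _ => Summable.tsum_finsetSum fun _ _ => ENNReal.summable
    _ = ∑ a ∈ A', ∑ b ∈ B', ecurrentSum K ((A' ∪ B') ∆ ({a} ∆ {b})) * ecurrentSum K ({a} ∆ {b}) := by
        refine Finset.sum_congr rfl fun a _ => Finset.sum_congr rfl fun b _ => ?_
        have h := tsum_epairWeight_switch_pair hK (A' ∪ B') a b (fun _ => 1)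
        rw [← h]
        simp only [mul_one]
        exact tsum_epairWeight K _ _

end Current

/-- `(∏ toReal)`-conversion: the free zero-field correlation on a finite graph as a ratio of
`ℝ≥0∞` current sums with constant coupling. [cite: DuminilCopin2016, §2.2, eq. (2.2)] -/
private theorem isingCorr_free_univ_eq_toReal_div (β : ℝ) (hβ : 0 ≤ β) (A : Finset V) :
    isingCorr G univ β 0 .free A =
      (ecurrentSum (fun _ : G.edgeFinset => β) A).toReal /
        (ecurrentSum (fun _ : G.edgeFinset => β) ∅).toReal := by
  rw [isingCorr_free_eq_currentSum_div_holds G β A, currentSum_eq_wcurrentSum, currentSum_eq_wcurrentSum,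
    toReal_ecurrentSum (fun _ => hβ), toReal_ecurrentSum (fun _ => hβ)]

/-- **The odd–odd bound on a finite graph, with the complementary correlations** (free b.c., zero
field, `β ≥ 0`, disjoint `A', B'`, `|A'|` odd):
`⟨σ_{A'∪B'}⟩ ≤ ∑_{a∈A'} ∑_{b∈B'} ⟨σ_{(A'∪B')∖{a,b}}⟩ ⟨σ_aσ_b⟩`.
[cite: DuminilCopinGoswamiRaoufi2020, proof of Lemma 1.2 (p. 8); Aizenman1982 §3] -/
theorem isingCorr_free_univ_oddUnion_le_sum_mul {β : ℝ} (hβ : 0 ≤ β) {A' B' : Finset V}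
    (hAB : Disjoint A' B') (hA : Odd A'.card) :
    isingCorr G univ β 0 .free (A' ∪ B') ≤
      ∑ a ∈ A', ∑ b ∈ B', isingCorr G univ β 0 .free ((A' ∪ B') ∆ ({a} ∆ {b})) *
        isingCorr G univ β 0 .free ({a} ∆ {b}) := by
  set K : G.edgeFinset → ℝ := fun _ => β with hKdef
  have hK : ∀ e, 0 ≤ K e := fun _ => hβ
  have hfin : ∀ S, ecurrentSum K S ≠ ∞ := fun S => ecurrentSum_ne_top hK S
  set z := (ecurrentSum K (∅ : Finset V)).toReal with hz
  have hzpos : 0 < z := ENNReal.toReal_pos (ecurrentSum_empty_ne_zero K) (hfin ∅)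
  have key : (ecurrentSum K (A' ∪ B')).toReal * z ≤
      ∑ a ∈ A', ∑ b ∈ B', (ecurrentSum K ((A' ∪ B') ∆ ({a} ∆ {b}))).toReal *
        (ecurrentSum K ({a} ∆ {b})).toReal := by
    have h := Current.ecurrentSum_oddUnion_mul_empty_le hK hAB hA
    have hne : ∑ a ∈ A', ∑ b ∈ B', ecurrentSum K ((A' ∪ B') ∆ ({a} ∆ {b})) * ecurrentSum K ({a} ∆ {b}) ≠ ∞ :=
      ENNReal.sum_ne_top.2 fun a _ => ENNReal.sum_ne_top.2 fun b _ => ENNReal.mul_ne_top (hfin _) (hfin _)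
    have hmono := (ENNReal.toReal_le_toReal (ENNReal.mul_ne_top (hfin _) (hfin _)) hne).2 h
    rw [ENNReal.toReal_mul, ENNReal.toReal_sum (fun a _ => ENNReal.sum_ne_top.2 fun b _ =>
      ENNReal.mul_ne_top (hfin _) (hfin _))] at hmono
    refine hmono.trans (le_of_eq (Finset.sum_congr rfl fun a _ => ?_))
    rw [ENNReal.toReal_sum fun b _ => ENNReal.mul_ne_top (hfin _) (hfin _)]
    exact Finset.sum_congr rfl fun b _ => ENNReal.toReal_mul
  simp only [isingCorr_free_univ_eq_toReal_div β hβ, ← hKdef, ← hz]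
  have hdiv : ∀ X Y : Finset V,
      (ecurrentSum K X).toReal / z * ((ecurrentSum K Y).toReal / z) =
        (ecurrentSum K X).toReal * (ecurrentSum K Y).toReal / (z * z) := fun X Y => by
    rw [div_mul_div_comm]
  simp only [hdiv, ← Finset.sum_div]
  rw [div_le_div_iff₀ hzpos (mul_pos hzpos hzpos)]
  calc (ecurrentSum K (A' ∪ B')).toReal * (z * z) = (ecurrentSum K (A' ∪ B')).toReal * z * z := by ring
    _ ≤ (∑ a ∈ A', ∑ b ∈ B', (ecurrentSum K ((A' ∪ B') ∆ ({a} ∆ {b}))).toReal *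
          (ecurrentSum K ({a} ∆ {b})).toReal) * z := mul_le_mul_of_nonneg_right key hzpos.le

/-- **The odd–odd bound on a finite graph**: free b.c., zero field, `β ≥ 0`, disjoint `A', B'`,
`|A'|` odd: `⟨σ_{A'∪B'}⟩ ≤ ∑_{a∈A'} ∑_{b∈B'} ⟨σ_aσ_b⟩` (`σ_aσ_b = σ_{{a}∆{b}}`).
[cite: DuminilCopinGoswamiRaoufi2020, proof of Lemma 1.2 (p. 8)] -/
theorem isingCorr_free_univ_oddUnion_le_sum {β : ℝ} (hβ : 0 ≤ β) {A' B' : Finset V}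
    (hAB : Disjoint A' B') (hA : Odd A'.card) :
    isingCorr G univ β 0 .free (A' ∪ B') ≤ ∑ a ∈ A', ∑ b ∈ B', isingCorr G univ β 0 .free ({a} ∆ {b}) := by
  refine (isingCorr_free_univ_oddUnion_le_sum_mul (G := G) hβ hAB hA).trans
    (Finset.sum_le_sum fun a _ => Finset.sum_le_sum fun b _ => ?_)
  have h1 : isingCorr G univ β 0 .free ((A' ∪ B') ∆ ({a} ∆ {b})) ≤ 1 :=
    (le_abs_self _).trans (abs_isingCorr_le_one G _ _ _ _ _)
  have h2 : 0 ≤ isingCorr G univ β 0 .free ({a} ∆ {b}) :=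
    GKSInequalities.gks_one_holds G hβ le_rfl (Or.inl rfl) (Finset.subset_univ _)
  nlinarith

end Finite

/-! ### §2 Finite volumes of locally finite graphs -/

section Volume

variable {V : Type*} [DecidableEq V] (G : SimpleGraph V) [G.LocallyFinite]

omit [DecidableEq V] [G.LocallyFinite] in
/-- The inclusion `Λ ↪ V` maps the whole vertex type of `↥Λ` onto `Λ`. [folklore] -/
private theorem univ_map_subtypeEmb_eq_self (Λ : Finset V) :
    (Finset.univ : Finset ↥Λ).map (Function.Embedding.subtype (· ∈ Λ)) = Λ := by
  ext y
  simp only [Finset.mem_map, Finset.mem_univ, true_and, Function.Embedding.coe_subtype, Subtype.exists,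
    exists_prop, exists_eq_right]

omit [G.LocallyFinite] in
/-- The image of `{a} ∆ {b} ⊆ ↥Λ` in `V` is `{a} ∆ {b}`. [folklore] -/
private theorem map_subtype_symmDiff_singleton' {Λ : Finset V} (a b : ↥Λ) :
    (({a} : Finset ↥Λ) ∆ {b}).map (Function.Embedding.subtype (· ∈ Λ)) =
      ({(a : V)} : Finset V) ∆ {(b : V)} := by
  ext v
  simp only [Finset.mem_map, Finset.mem_symmDiff, Finset.mem_singleton, Function.Embedding.coe_subtype]
  constructor
  · rintro ⟨w, hw, rfl⟩
    rcases hw with ⟨rfl, h2⟩ | ⟨rfl, h2⟩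
    · exact Or.inl ⟨rfl, fun h' => h2 (Subtype.ext h')⟩
    · exact Or.inr ⟨rfl, fun h' => h2 (Subtype.ext h')⟩
  · rintro (⟨hv, h2⟩ | ⟨hv, h2⟩)
    · exact ⟨a, Or.inl ⟨rfl, fun h' => h2 (hv.trans (congrArg Subtype.val h'))⟩, hv.symm⟩
    · exact ⟨b, Or.inr ⟨rfl, fun h' => h2 (hv.trans (congrArg Subtype.val h'))⟩, hv.symm⟩

/-- **The odd–odd bound in a finite volume of a locally finite graph**: free boundary condition,
zero field, `β ≥ 0`, `A', B' ⊆ Λ` disjoint, `|A'|` odd: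
`⟨σ_{A'∪B'}⟩^∅_{Λ;β,0} ≤ ∑_{a∈A'} ∑_{b∈B'} ⟨σ_aσ_b⟩^∅_{Λ;β,0}` (transport to the finite graph induced
on `Λ`, `isingCorr_free_map`). [cite: DuminilCopinGoswamiRaoufi2020, proof of Lemma 1.2 (p. 8)] -/
theorem isingCorr_free_oddUnion_le_sum {β : ℝ} (hβ : 0 ≤ β) {Λ A' B' : Finset V} (hA' : A' ⊆ Λ)
    (hB' : B' ⊆ Λ) (hAB : Disjoint A' B') (hA : Odd A'.card) :
    isingCorr G Λ β 0 .free (A' ∪ B') ≤ ∑ a ∈ A', ∑ b ∈ B', isingCorr G Λ β 0 .free ({a} ∆ {b}) := by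
  classical
  set emb := Function.Embedding.subtype (· ∈ Λ) with hemb
  have htr : ∀ X : Finset ↥Λ, isingCorr G Λ β 0 .free (X.map emb) =
      isingCorr (G.comap emb) univ β 0 .free X := by
    intro X
    have h := isingCorr_free_map (G := G.comap emb) (G' := G) emb (Λ := Finset.univ)
      (fun _ _ _ _ => Iff.rfl) β 0 X
    rw [univ_map_subtypeEmb_eq_self] at h
    exact h
  -- pull `A', B'` back to `↥Λ`
  have hA'eq : (inVol Λ A').map emb = A' := map_inVol_of_subset hA'
  have hB'eq : (inVol Λ B').map emb = B' := map_inVol_of_subset hB'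
  have hdisj : Disjoint (inVol Λ A') (inVol Λ B') := by
    rw [← Finset.disjoint_map emb, hA'eq, hB'eq]; exact hAB
  have hodd : Odd (inVol Λ A').card := by rw [card_inVol_of_subset hA']; exact hA
  have hunion : ((inVol Λ A') ∪ (inVol Λ B')).map emb = A' ∪ B' := by
    rw [Finset.map_union, hA'eq, hB'eq]
  rw [← hunion, htr]
  conv_rhs => rw [← hA'eq]
  rw [Finset.sum_map]
  refine (isingCorr_free_univ_oddUnion_le_sum (G := G.comap emb) hβ hdisj hodd).trans
    (le_of_eq (Finset.sum_congr rfl fun a _ => ?_))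
  conv_rhs => rw [← hB'eq]
  rw [Finset.sum_map]
  refine Finset.sum_congr rfl fun b _ => ?_
  rw [← htr, map_subtype_symmDiff_singleton']
  rfl

end Volume

/-! ### §3 The sharp covariance bound: `Cov(σ_A, σ_B) ≤ ∑_{a∈A,b∈B} ⟨σ_a;σ_b⟩` with a field -/

section Sharp

variable {V : Type*} [DecidableEq V] (G : SimpleGraph V) [G.LocallyFinite]

/-- **Duminil-Copin–Goswami–Raoufi 2020, Lemma 1.2, SHARP form, general graphs.** Ferromagnetic
nearest-neighbour Ising model on a finite volume `Λ` of a locally finite graph, free or plus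
boundary condition, `β, h ≥ 0`, `A, B ⊆ Λ` disjoint (`σ_Aσ_B = σ_{A∆B}`):
`⟨σ_Aσ_B⟩ - ⟨σ_A⟩⟨σ_B⟩ ≤ ∑_{a∈A} ∑_{b∈B} (⟨σ_aσ_b⟩ - ⟨σ_a⟩⟨σ_b⟩)` — the printed constant
`2^{|A|+|B|-4}` replaced by `1`. Proof: Ginibre's duplicated system
(`gksExpect_cov_le_mul_sum_truncated_of_oddOdd` with `c = 1`), whose inner systems are free zero-field
models on the regions `R = {τ = -1}` at `2β` (`gksExpect_twistIn_ising_eq_isingCorr_free`), and the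
odd–odd bound §2 there. [cite: DuminilCopinGoswamiRaoufi2020, Lemma 1.2; FriedliVelenik2017 proof of Thm. 3.49 (p. 142)] -/
theorem isingCorr_cov_disjoint_le_sum_truncated {β h : ℝ} (hβ : 0 ≤ β) (hh : 0 ≤ h)
    {bc : BoundaryCondition V} (hbc : bc = .free ∨ bc = .plus) (Λ : Finset V)
    {A B : Finset V} (hA : A ⊆ Λ) (hB : B ⊆ Λ) (hAB : Disjoint A B) :
    isingCorr G Λ β h bc (A ∆ B) - isingCorr G Λ β h bc A * isingCorr G Λ β h bc B ≤
      ∑ a ∈ A, ∑ b ∈ B, (isingCorr G Λ β h bc ({a} ∆ {b}) - isingCorr G Λ β h bc {a} * isingCorr G Λ β h bc {b}) := by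
  classical
  set s := isingIdx G Λ with hs
  set K := gksCoupling G Λ β h bc with hK'
  set C := isingSupp Λ with hC'
  have hK : ∀ i ∈ s, 0 ≤ K i := gksCoupling_nonneg G hβ hh hbc
  have hC2 : ∀ i ∈ s, (C i).card ≤ 2 := fun i _ => card_isingSupp_le_two Λ i
  have hcorr : ∀ {X : Finset V}, X ⊆ Λ → isingCorr G Λ β h bc X = gksExpect s K C (spinProduct (inVol Λ X)) :=
    fun hX => isingCorr_eq_gksExpect G Λ β h bc hX
  have hsing : ∀ {u : V} (hu : u ∈ Λ), inVol Λ ({u} : Finset V) = {⟨u, hu⟩} := by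
    intro u hu; ext z
    simp only [mem_inVol, Finset.mem_singleton, Subtype.ext_iff]
  have hABΛ : A ∆ B ⊆ Λ := (Finset.symmDiff_subset_union (s := A) (t := B)).trans (Finset.union_subset hA hB)
  rw [hcorr hABΛ, hcorr hA, hcorr hB, inVol_symmDiff]
  have hrhs : ∑ a ∈ A, ∑ b ∈ B, (isingCorr G Λ β h bc ({a} ∆ {b}) -
        isingCorr G Λ β h bc {a} * isingCorr G Λ β h bc {b}) =
      1 * ∑ a ∈ inVol Λ A, ∑ b ∈ inVol Λ B, (gksExpect s K C (spinProduct ({a} ∆ {b})) -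
        gksExpect s K C (spinProduct {a}) * gksExpect s K C (spinProduct {b})) := by
    rw [one_mul]
    conv_lhs => rw [← map_inVol_of_subset hA]
    rw [Finset.sum_map]
    refine Finset.sum_congr rfl fun a ha => ?_
    conv_lhs => rw [← map_inVol_of_subset hB]
    rw [Finset.sum_map]
    refine Finset.sum_congr rfl fun b hb => ?_
    have haΛ : (a : V) ∈ Λ := a.2
    have hbΛ : (b : V) ∈ Λ := b.2
    simp only [Function.Embedding.coe_subtype]
    rw [hcorr (X := {(a : V)} ∆ {(b : V)})
        ((Finset.symmDiff_subset_union (s := {(a : V)}) (t := {(b : V)})).trans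
          (Finset.union_subset (Finset.singleton_subset_iff.2 haΛ) (Finset.singleton_subset_iff.2 hbΛ))),
      hcorr (Finset.singleton_subset_iff.2 haΛ), hcorr (Finset.singleton_subset_iff.2 hbΛ),
      inVol_symmDiff, hsing haΛ, hsing hbΛ]
  rw [hrhs]
  have hABv : Disjoint (inVol Λ A) (inVol Λ B) := by
    rw [Finset.disjoint_left]
    intro z hzA hzB
    exact Finset.disjoint_left.1 hAB (mem_inVol.1 hzA) (mem_inVol.1 hzB)
  refine gksExpect_cov_le_mul_sum_truncated_of_oddOdd s K C hK hC2 hABv zero_le_one fun τ hAodd hBodd => ?_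
  -- the odd–odd hypothesis with constant `1`: free zero-field model on `R'` at `2β`
  set R := univ.filter fun y : ↥Λ => spinAt y τ = -1 with hR
  set emb := Function.Embedding.subtype fun x : V => x ∈ Λ with hemb
  set R' := R.map emb with hR'def
  set A₁ := (inVol Λ A ∩ R).map emb with hA₁
  set B₁ := (inVol Λ B ∩ R).map emb with hB₁
  have hbridge : ∀ Y : Finset ↥Λ, Y ⊆ R →
      gksExpect s (fun i => if C i ⊆ R then K i + K i * spinProduct (C i) τ else 0) C (spinProduct Y) =
        isingCorr G R' (2 * β) 0 .free (Y.map emb) :=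
    fun Y hY => gksExpect_twistIn_ising_eq_isingCorr_free G β h hbc τ hY
  have hA₁R : A₁ ⊆ R' := Finset.map_subset_map.2 Finset.inter_subset_right
  have hB₁R : B₁ ⊆ R' := Finset.map_subset_map.2 Finset.inter_subset_right
  have hdisj₁ : Disjoint A₁ B₁ :=
    (Finset.disjoint_map emb).2 (hABv.mono Finset.inter_subset_left Finset.inter_subset_left)
  have hA₁odd : Odd A₁.card := by rw [hA₁, Finset.card_map]; exact hAodd
  have hβ2 : 0 ≤ 2 * β := by positivity
  have hY : (inVol Λ A ∪ inVol Λ B) ∩ R ⊆ R := Finset.inter_subset_right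
  have hYmap : ((inVol Λ A ∪ inVol Λ B) ∩ R).map emb = A₁ ∪ B₁ := by
    rw [Finset.union_inter_distrib_right, Finset.map_union]
  rw [hbridge _ hY, hYmap, one_mul]
  refine (isingCorr_free_oddUnion_le_sum G hβ2 hA₁R hB₁R hdisj₁ hA₁odd).trans (le_of_eq ?_)
  rw [hA₁, Finset.sum_map]
  refine Finset.sum_congr rfl fun a ha => ?_
  rw [hB₁, Finset.sum_map]
  refine Finset.sum_congr rfl fun b hb => ?_
  have hab : ({a} : Finset ↥Λ) ∆ {b} ⊆ R := by
    intro z hz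
    rw [Finset.mem_symmDiff, Finset.mem_singleton, Finset.mem_singleton] at hz
    rcases hz with ⟨rfl, -⟩ | ⟨rfl, -⟩
    · exact (Finset.mem_inter.1 ha).2
    · exact (Finset.mem_inter.1 hb).2
  rw [hbridge _ hab, map_subtype_symmDiff_singleton']
  rfl

/-- **Both inequalities**: `0 ≤ ⟨σ_Aσ_B⟩ - ⟨σ_A⟩⟨σ_B⟩ ≤ ∑_{a∈A,b∈B} ⟨σ_a;σ_b⟩` (free or plus b.c.,
`β, h ≥ 0`, disjoint `A, B ⊆ Λ`; the lower bound is GKS II). [cite: DuminilCopinGoswamiRaoufi2020, Lemma 1.2] -/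
theorem isingCorr_cov_disjoint_mem_Icc_sum {β h : ℝ} (hβ : 0 ≤ β) (hh : 0 ≤ h)
    {bc : BoundaryCondition V} (hbc : bc = .free ∨ bc = .plus) (Λ : Finset V)
    {A B : Finset V} (hA : A ⊆ Λ) (hB : B ⊆ Λ) (hAB : Disjoint A B) :
    0 ≤ isingCorr G Λ β h bc (A ∆ B) - isingCorr G Λ β h bc A * isingCorr G Λ β h bc B ∧
      isingCorr G Λ β h bc (A ∆ B) - isingCorr G Λ β h bc A * isingCorr G Λ β h bc B ≤
        ∑ a ∈ A, ∑ b ∈ B, (isingCorr G Λ β h bc ({a} ∆ {b}) -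
          isingCorr G Λ β h bc {a} * isingCorr G Λ β h bc {b}) :=
  ⟨sub_nonneg.2 (GKSInequalities.gks_two_holds G hβ hh hbc hA hB),
    isingCorr_cov_disjoint_le_sum_truncated G hβ hh hbc Λ hA hB hAB⟩

end Sharp

/-! ### §4 The plus and free states of `ℤ^d` -/

section Zd

variable {d : ℕ}

/-- **The sharp Lemma 1.2 in the PLUS state of `ℤ^d`** (`β, h ≥ 0`, disjoint `A, B`):
`0 ≤ ⟨σ_Aσ_B⟩⁺ - ⟨σ_A⟩⁺⟨σ_B⟩⁺ ≤ ∑_{a∈A} ∑_{b∈B} (⟨σ_aσ_b⟩⁺ - ⟨σ_a⟩⁺⟨σ_b⟩⁺)`.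
[cite: DuminilCopinGoswamiRaoufi2020, Lemma 1.2 (plus state)] -/
theorem plusCorr_cov_disjoint_le_sum_truncated {β h : ℝ} (hβ : 0 ≤ β) (hh : 0 ≤ h)
    {A B : Finset (Site d)} (hAB : Disjoint A B) :
    0 ≤ plusCorr d β h (A ∆ B) - plusCorr d β h A * plusCorr d β h B ∧
      plusCorr d β h (A ∆ B) - plusCorr d β h A * plusCorr d β h B ≤
        ∑ a ∈ A, ∑ b ∈ B, (plusCorr d β h ({a} ∆ {b}) - plusCorr d β h {a} * plusCorr d β h {b}) := by
  have hl : ∀ X : Finset (Site d), Tendsto (fun L : ℕ => isingCorr (zdGraph d) (box d L) β h .plus X)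
      atTop (𝓝 (plusCorr d β h X)) := fun X => hasBoxLimit_isingCorr_plus_holds hβ hh X
  have hL : Tendsto (fun L : ℕ => isingCorr (zdGraph d) (box d L) β h .plus (A ∆ B) -
      isingCorr (zdGraph d) (box d L) β h .plus A * isingCorr (zdGraph d) (box d L) β h .plus B) atTop
      (𝓝 (plusCorr d β h (A ∆ B) - plusCorr d β h A * plusCorr d β h B)) := (hl _).sub ((hl _).mul (hl _))
  have hR : Tendsto (fun L : ℕ => ∑ a ∈ A, ∑ b ∈ B,
      (isingCorr (zdGraph d) (box d L) β h .plus ({a} ∆ {b}) -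
        isingCorr (zdGraph d) (box d L) β h .plus {a} * isingCorr (zdGraph d) (box d L) β h .plus {b})) atTop
      (𝓝 (∑ a ∈ A, ∑ b ∈ B, (plusCorr d β h ({a} ∆ {b}) - plusCorr d β h {a} * plusCorr d β h {b}))) :=
    tendsto_finsetSum _ fun a _ => tendsto_finsetSum _ fun b _ => (hl _).sub ((hl _).mul (hl _))
  obtain ⟨L₀, hL₀⟩ := exists_forall_subset_box d (A ∪ B)
  have hev : ∀ᶠ L : ℕ in atTop, A ⊆ box d L ∧ B ⊆ box d L := by
    filter_upwards [eventually_ge_atTop L₀] with L hLL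
    exact ⟨Finset.subset_union_left.trans (hL₀ L hLL), Finset.subset_union_right.trans (hL₀ L hLL)⟩
  refine ⟨ge_of_tendsto hL ?_, le_of_tendsto_of_tendsto hL hR ?_⟩
  · filter_upwards [hev] with L hLsub
    exact (isingCorr_cov_disjoint_mem_Icc_sum (zdGraph d) hβ hh (Or.inr rfl) (box d L) hLsub.1 hLsub.2 hAB).1
  · filter_upwards [hev] with L hLsub
    exact (isingCorr_cov_disjoint_mem_Icc_sum (zdGraph d) hβ hh (Or.inr rfl) (box d L) hLsub.1 hLsub.2 hAB).2

/-- **The sharp Lemma 1.2 in the FREE state of `ℤ^d`** (`β, h ≥ 0`, disjoint `A, B`).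
[cite: DuminilCopinGoswamiRaoufi2020, Lemma 1.2] -/
theorem freeCorr_cov_disjoint_le_sum_truncated {β h : ℝ} (hβ : 0 ≤ β) (hh : 0 ≤ h)
    {A B : Finset (Site d)} (hAB : Disjoint A B) :
    0 ≤ freeCorr d β h (A ∆ B) - freeCorr d β h A * freeCorr d β h B ∧
      freeCorr d β h (A ∆ B) - freeCorr d β h A * freeCorr d β h B ≤
        ∑ a ∈ A, ∑ b ∈ B, (freeCorr d β h ({a} ∆ {b}) - freeCorr d β h {a} * freeCorr d β h {b}) := by
  have hl : ∀ X : Finset (Site d), Tendsto (fun L : ℕ => isingCorr (zdGraph d) (box d L) β h .free X)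
      atTop (𝓝 (freeCorr d β h X)) := fun X => hasBoxLimit_isingCorr_free_holds hβ hh X
  have hL : Tendsto (fun L : ℕ => isingCorr (zdGraph d) (box d L) β h .free (A ∆ B) -
      isingCorr (zdGraph d) (box d L) β h .free A * isingCorr (zdGraph d) (box d L) β h .free B) atTop
      (𝓝 (freeCorr d β h (A ∆ B) - freeCorr d β h A * freeCorr d β h B)) := (hl _).sub ((hl _).mul (hl _))
  have hR : Tendsto (fun L : ℕ => ∑ a ∈ A, ∑ b ∈ B,
      (isingCorr (zdGraph d) (box d L) β h .free ({a} ∆ {b}) -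
        isingCorr (zdGraph d) (box d L) β h .free {a} * isingCorr (zdGraph d) (box d L) β h .free {b})) atTop
      (𝓝 (∑ a ∈ A, ∑ b ∈ B, (freeCorr d β h ({a} ∆ {b}) - freeCorr d β h {a} * freeCorr d β h {b}))) :=
    tendsto_finsetSum _ fun a _ => tendsto_finsetSum _ fun b _ => (hl _).sub ((hl _).mul (hl _))
  obtain ⟨L₀, hL₀⟩ := exists_forall_subset_box d (A ∪ B)
  have hev : ∀ᶠ L : ℕ in atTop, A ⊆ box d L ∧ B ⊆ box d L := by
    filter_upwards [eventually_ge_atTop L₀] with L hLL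
    exact ⟨Finset.subset_union_left.trans (hL₀ L hLL), Finset.subset_union_right.trans (hL₀ L hLL)⟩
  refine ⟨ge_of_tendsto hL ?_, le_of_tendsto_of_tendsto hL hR ?_⟩
  · filter_upwards [hev] with L hLsub
    exact (isingCorr_cov_disjoint_mem_Icc_sum (zdGraph d) hβ hh (Or.inl rfl) (box d L) hLsub.1 hLsub.2 hAB).1
  · filter_upwards [hev] with L hLsub
    exact (isingCorr_cov_disjoint_mem_Icc_sum (zdGraph d) hβ hh (Or.inl rfl) (box d L) hLsub.1 hLsub.2 hAB).2

end Zd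

end Literature.Probability.LatticeModels
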